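import Literature.NumberTheory.Automorphic.BCDTTheoremBWildAtThreeDet
import Literature.NumberTheory.GaloisRepresentations.FrobeniusGeneration
import HarnessLib

/-!
# BCDT Theorem 2.2.1, cases 2–6: the image of the decomposition group at `3`, case by case

Topic `NumberTheory/Automorphic`; a companion of
`Literature.NumberTheory.Automorphic.BCDTTheoremBWildAtThree` and `…WildAtThreeDet`, landed by the
tenured seat of the named fact `Literature.NumberTheory.Automorphic.BCDT.theoremB`
(Breuil–Conrad–Diamond–Taylor 2001, Thm. B = Thm. 2.2.1) as a further bottom-up step INSIDE the
one remaining opaque piece of its printed proof, the wild case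
`exists_isTorsionGaloisRep_and_isModular_of_not_isTamelyRamifiedAbove` (BCDT §2.2, cases 2–6).

C. Breuil, B. Conrad, F. Diamond, R. Taylor, J. Amer. Math. Soc. 14 (2001) [BCDTJAMS2001], proof
of Theorem 2.2.1 (p. 860), for `ρ̄ : G_ℚ → GL₂(𝔽₅)` absolutely irreducible with cyclotomic
determinant: *"Then up to equivalence and twisting by a quadratic character, one of the following
possibilities can be attained. 1. `ρ̄` is tamely ramified at `3`. 2. `ρ̄|_{G₃}` is given by the
character `ℚ₃^× → 𝔽₅(τ)^×` determined by `3 ↦ τⁱ(τ - τ⁻¹)`, `-1 ↦ 1`, `4 ↦ τ`.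
3. `ρ̄|_{G_{ℚ₃(√-1)}}` is given by the character `ℚ₃(√-1)^× → 𝔽₅(τ)^×` … 4.–6. `ρ̄|_{G_{ℚ₃(√±3)}}`
is given by the character `ℚ₃(√±3)^× → 𝔽₅(τ)^×` determined by `√±3 ↦ τ - τ⁻¹`, `-1 ↦ -1`, …"*.

`…WildAtThree` and `…WildAtThreeDet` proved, for `ρ̄` with `det ρ̄ = χ̄₅` NOT tamely ramified above
`3`, after a conjugation `ρ̄ˣ = xρ̄x⁻¹` at a prime `𝔓 ∣ 3` of `ℚ̄`: `ρ̄ˣ(D_𝔓) ≤ N(𝔽₅(τ)^×)`,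
`ρ̄ˣ(wild inertia) = ⟨τ⟩`, `ρ̄ˣ(I_𝔓) ∈ {⟨τ⟩, ⟨τ, -1⟩, ⟨τ, σ⟩}`, `det ρ̄ˣ(Frob) = 3`, and the split of
`D_𝔓` by the index-`≤ 2` subgroup `H = ρ̄ˣ⁻¹(𝔽₅(τ)^×)`.  This file finishes the Galois-side case
table of p. 860 by determining the **image of the whole decomposition group `ρ̄ˣ(D_𝔓) = ρ̄(G₃)`**
and the **Frobenius**, in each of BCDT's three situations (case 2 / case 3 / cases 4–6), using the
tree's theorem that `D_𝔓` is generated by `I_𝔓` and a Frobenius in every finite quotient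
(`FrobeniusGeneration.exists_eq_frobenius_pow_mul_of_mem_decompositionSubgroup`, Neukirch I (9.4)):

* `GL2F5OrderThree.nu` — the element **`ν = τ - τ⁻¹ = 1 + 2τ ∈ 𝔽₅(τ)^×`** of BCDT's third bullet
  and of the values "`3 ↦ τⁱ(τ - τ⁻¹)`", "`√±3 ↦ τ - τ⁻¹`", with `det ν = 3`, `ν² = 2`, `ν⁴ = -1`
  (so `ν` has order `8`), `σνσ⁻¹ = -ν`, and **`𝔽₅(τ)^× = ⟨τ, ν⟩`** (`closure_tau_nu_eq_unitsF5Tau`,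
  a `decide` certificate on the model `M2`: every non-zero `a + cτ` is `τʲνᵏ`);
  `eq_tau_pow_mul_nu_or_of_mem_unitsF5Tau_of_det_eq_three` — the elements of `𝔽₅(τ)^×` of norm `3`
  are the `±τⁱν` (group-element form of `…WildAtThreeDet`'s matrix statement);
* `isArithFrobAt_mul_of_mem_inertia` (and `…_left`) — an arithmetic Frobenius times an element of
  the inertia group is an arithmetic Frobenius (general `G ↷ S ⊇ R`);
* `map_decompositionSubgroup_eq_map_inertia_sup_zpowers` — for a number field `K`, `𝔓 ∣ v`, a
  Frobenius `φ` and any homomorphism `f : Γ_K → H` with open kernel,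
  **`f(D_𝔓) = f(I_𝔓) ⊔ ⟨f φ⟩`**;
* **`BCDT.exists_conj_cases_of_not_isTamelyRamifiedAbove_three_of_det`** — for `ρ̄ : Γ_ℚ → GL₂(𝔽₅)`
  continuous with `det ρ̄ = χ̄₅` and not tamely ramified above `3`, at some `𝔓 ∣ 3` and after a
  conjugation, with `f = ρ̄ˣ`, `D = D_𝔓`, `I = I_𝔓`, `H = f⁻¹(𝔽₅(τ)^×)`, exactly one of:
  - **case 2** (`D ≤ H`): `f(D) = 𝔽₅(τ)^×` — the whole of `G₃` acts through the non-split Cartan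
    subgroup `𝔽₂₅^×` ("`ρ̄|_{G₃}` is given by a character `ℚ₃^× → 𝔽₅(τ)^×`"), `f(I) = ⟨τ⟩` or
    `⟨τ, -1⟩` ("`4 ↦ τ`", "`-1 ↦ ±1`", the sign removed by a ramified quadratic twist), and there is
    an arithmetic Frobenius `φ` with `f φ = ±ν` ("`3 ↦ τⁱ(τ - τ⁻¹)`": every Frobenius has
    `f φ = ±τⁱν`, the `τⁱ` absorbed into the choice of `φ` modulo wild inertia, the sign being the
    unramified quadratic twist);
  - **case 3** (`I ≤ H`, `D ≰ H`): `[D : H ∩ D] = 2` with `I ≤ H` (the unramified quadratic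
    `ℚ₃(√-1)`), every arithmetic Frobenius `φ` has `f φ ∉ 𝔽₅(τ)^×`, `(f φ)² = 2`, `(f φ)⁴ = -1`, and
    `f(D) = ⟨τ⟩ ⋊ ⟨f φ⟩ = ⟨τ⟩ ⊔ ⟨f φ⟩` (order `24`, `f φ` acting on `⟨τ⟩` by inversion);
  - **cases 4–6** (`I ≰ H`): `[D : H ∩ D] = 2` (a ramified quadratic `ℚ₃(√±3)`),
    `f(I) = ⟨τ, σ⟩`, `f(I ∩ H) = ⟨τ, -1⟩ = μ₆` ("`-1 ↦ -1`" on the inertia of the quadratic field,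
    "`1 + √±3 ↦ τ`"-type wild part), there is an arithmetic Frobenius `φ ∈ H` with **`f φ = ν`
    exactly** ("`√±3 ↦ τ - τ⁻¹`", normalised by inertia), and `f(D) = N(𝔽₅(τ)^×)`, the full
    normaliser (order `48`).

What is NOT done here (unchanged): the identification of `D_𝔓 ⊂ Γ_ℚ` with `G₃ = Gal(ℚ̄₃/ℚ₃)`
together with local class field theory, which turns these data into the printed characters of
`ℚ₃^×`, `ℚ₃(√-1)^×`, `ℚ₃(√±3)^×`, and the quadratic-twist normalisation itself.

## References

* [BCDTJAMS2001] C. Breuil, B. Conrad, F. Diamond, R. Taylor, J. Amer. Math. Soc. 14 (2001),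
  §2.2, proof of Thm. 2.2.1, p. 860 (cases 1–6 and the three bulleted facts).
* [NeukirchANT1999] J. Neukirch, *Algebraic Number Theory*, Ch. I §9, Prop. (9.4)–(9.5)
  (`G_𝔓/I_𝔓` is generated by the Frobenius).
* [SerreLocalFields1979] J.-P. Serre, *Local Fields*, Ch. I §7–§8, Ch. IV §§1–3.

## Design

One definition (`GL2F5OrderThree.nu`, an explicit element of `GL₂(𝔽₅)` on the model `M2` of
`GL2F5OrderThree`) and theorems; `noncomputable section`; namespaces
`Literature.NumberTheory.GaloisRepresentations.GL2F5OrderThree`,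
`Literature.NumberTheory.GaloisRepresentations` and `Literature.NumberTheory.Automorphic.BCDT`.
No instances, no `sorry`, no named facts.  Axioms: `propext`, `Classical.choice`, `Quot.sound`.
-/

noncomputable section

open scoped NumberField Pointwise
open IsDedekindDomain

namespace Literature.NumberTheory.GaloisRepresentations.GL2F5OrderThree

/-! ## The element `ν = τ - τ⁻¹` and the generation `𝔽₅(τ)^× = ⟨τ, ν⟩` -/

namespace M2

/-- `(1 + 2τ)(3 + τ) = 1 = (3 + τ)(1 + 2τ)`: the inverse of `ν = 1 + 2τ` is `3ν = 3 + τ`. [folklore] -/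
theorem nu_cert : mul (lin 1 2) (lin 3 1) = one ∧ mul (lin 3 1) (lin 1 2) = one := by
  decide

/-- `ν² = 2` and `ν⁴ = -1` on the model. [folklore] -/
theorem nu_sq_cert : mul (lin 1 2) (lin 1 2) = ⟨2, 0, 0, 2⟩ ∧
    mul (mul (lin 1 2) (lin 1 2)) (mul (lin 1 2) (lin 1 2)) = neg one := by
  decide

/-- `σν = (-ν)σ`, i.e. `σνσ⁻¹ = -ν` (the relation of BCDT's third bullet). [folklore] -/
theorem sigma_nu_cert : mul sigma (lin 1 2) = mul (neg (lin 1 2)) sigma := by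
  decide

/-- **Every non-zero `a + cτ ∈ 𝔽₅(τ)` is `τʲ νᵏ` with `j < 3`, `k < 8`** (`𝔽₂₅^× = μ₃ × ⟨ν⟩`,
`ν = 1 + 2τ` of order `8`): a `decide` certificate with the powers written as iterates of
left multiplication. [folklore] -/
theorem gen_cert : ∀ a c : ZMod 5, (a ≠ 0 ∨ c ≠ 0) →
    ∃ j : Fin 3, ∃ k : Fin 8,
      lin a c = mul ((mul tau)^[(j : ℕ)] one) ((mul (lin 1 2))^[(k : ℕ)] one) := by
  decide

end M2

open Matrix

/-- **`ν = τ - τ⁻¹ = 1 + 2τ = (1 -2; 2 -1) ∈ GL₂(𝔽₅)`**, the element of `𝔽₅(τ)^×` of norm `3`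
appearing in BCDT's case list ("`3 ↦ τⁱ(τ - τ⁻¹)`", "`√±3 ↦ τ - τ⁻¹`") and third bullet
("`α = ±(τ - τ⁻¹)`"). [cite: BCDTJAMS2001, §2.2 (proof of Thm. 2.2.1, p. 860)] -/
def nu : GL (Fin 2) (ZMod 5) :=
  toGL (M2.lin 1 2) (M2.lin 3 1) M2.nu_cert.1 M2.nu_cert.2

/-- The encoding of `ν` is `1 + 2τ`. [folklore] -/
theorem enc_nu : enc nu = M2.lin 1 2 :=
  M2.ofMat_toMat _

/-- `ν = τ - τ⁻¹` as matrices. [folklore] -/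
theorem val_nu : ((nu : GL (Fin 2) (ZMod 5)) : Matrix (Fin 2) (Fin 2) (ZMod 5)) =
    (tau : Matrix (Fin 2) (Fin 2) (ZMod 5)) - ((tau⁻¹ : GL (Fin 2) (ZMod 5)) : Matrix (Fin 2) (Fin 2) (ZMod 5)) := by
  rw [val_tau, val_tau_inv, ← M2.toMat_lin_one_two.1]; rfl

/-- `ν = (1 -2; 2 -1)`. [folklore] -/
theorem val_nu_eq : ((nu : GL (Fin 2) (ZMod 5)) : Matrix (Fin 2) (Fin 2) (ZMod 5)) = !![1, -2; 2, -1] := by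
  rw [val_nu, val_tau_sub_val_tau_inv]

/-- `ν ∈ 𝔽₅(τ)^×`. [folklore] -/
theorem nu_mem_unitsF5Tau : nu ∈ unitsF5Tau :=
  (mem_unitsF5Tau_iff_exists_enc_eq nu).mpr ⟨1, 2, enc_nu⟩

/-- `det ν = 3` (the norm of `1 + 2τ ∈ 𝔽₂₅`). [folklore] -/
theorem det_nu : (Matrix.GeneralLinearGroup.det nu : ZMod 5) = 3 := by
  rw [Matrix.GeneralLinearGroup.val_det_apply, ← toMat_enc, enc_nu, M2.det_toMat]; decide

/-- `ν² = 2` (a scalar). [folklore] -/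
theorem val_nu_sq : ((nu ^ 2 : GL (Fin 2) (ZMod 5)) : Matrix (Fin 2) (Fin 2) (ZMod 5)) =
    (2 : ZMod 5) • (1 : Matrix (Fin 2) (Fin 2) (ZMod 5)) := by
  rw [← toMat_enc, pow_two, enc_mul, enc_nu, M2.nu_sq_cert.1]
  ext i j; fin_cases i <;> fin_cases j <;> rfl

/-- `ν⁴ = -1`. [folklore] -/
theorem nu_pow_four : nu ^ 4 = -1 := by
  apply enc_injective
  rw [show (4 : ℕ) = 2 + 2 from rfl, pow_add, enc_mul, pow_two, enc_mul, enc_nu, enc_neg, enc_one]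
  exact M2.nu_sq_cert.2

/-- `ν⁸ = 1`. [folklore] -/
theorem nu_pow_eight : nu ^ 8 = 1 := by
  rw [show (8 : ℕ) = 4 + 4 from rfl, pow_add, nu_pow_four, neg_mul_neg, one_mul]

/-- `ν` has order `8`. [folklore] -/
theorem orderOf_nu : orderOf nu = 8 := by
  refine orderOf_eq_of_pow_and_pow_div_prime (by norm_num) nu_pow_eight fun p hp hp8 ↦ ?_
  have hp2 : p = 2 :=
    (Nat.prime_dvd_prime_iff_eq hp Nat.prime_two).mp
      (hp.dvd_of_dvd_pow (show p ∣ 2 ^ 3 by simpa using hp8))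
  subst hp2
  rw [show 8 / 2 = 4 from rfl, nu_pow_four]
  intro h
  have h2 := congrArg enc h
  rw [enc_neg, enc_one] at h2
  exact absurd h2 (by decide)

/-- `σνσ⁻¹ = -ν`: conjugation by `σ` (the Frobenius of `𝔽₂₅/𝔽₅`) negates `ν`, i.e. `ν̄ = -ν`
(`ν = 1 + 2τ`, `ν̄ = 1 + 2τ² = -1 - 2τ`). [cite: BCDTJAMS2001, §2.2 (proof of Thm. 2.2.1, p. 860, third bullet)] -/
theorem sigma_mul_nu_mul_sigma_inv : sigma * nu * sigma⁻¹ = -nu := by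
  rw [mul_inv_eq_iff_eq_mul]
  apply enc_injective
  rw [enc_mul, enc_mul, enc_neg, enc_sigma, enc_nu]
  exact M2.sigma_nu_cert

/-- `τ` and `ν` commute (both lie in `𝔽₅(τ)^×`). [folklore] -/
theorem tau_mul_nu : tau * nu = nu * tau :=
  mul_comm_of_mem_unitsF5Tau tau_mem_unitsF5Tau nu_mem_unitsF5Tau

/-- Powers on the encoding: `enc (gⁿ)` is the `n`-th iterate of left multiplication by `enc g`.
[folklore] -/
theorem enc_pow (g : GL (Fin 2) (ZMod 5)) (n : ℕ) : enc (g ^ n) = (M2.mul (enc g))^[n] M2.one := by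
  induction n with
  | zero => rw [pow_zero, enc_one, Function.iterate_zero_apply]
  | succ n ih => rw [pow_succ', enc_mul, ih, Function.iterate_succ_apply']

/-- **`𝔽₅(τ)^× = ⟨τ, ν⟩`**: the non-split Cartan subgroup (cyclic of order `24`) is generated by
`τ` (order `3`) and `ν = τ - τ⁻¹` (order `8`). [folklore] -/
theorem closure_tau_nu_eq_unitsF5Tau :
    Subgroup.closure ({tau, nu} : Set (GL (Fin 2) (ZMod 5))) = unitsF5Tau := by
  apply le_antisymm
  · refine (Subgroup.closure_le _).mpr ?_
    intro u hu
    simp only [Set.mem_insert_iff, Set.mem_singleton_iff] at hu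
    rcases hu with rfl | rfl
    · exact tau_mem_unitsF5Tau
    · exact nu_mem_unitsF5Tau
  · intro g hg
    obtain ⟨a, c, hg'⟩ := (mem_unitsF5Tau_iff_exists_enc_eq g).mp hg
    have hac : a ≠ 0 ∨ c ≠ 0 := by
      by_contra h
      push Not at h
      obtain ⟨rfl, rfl⟩ := h
      have hdet : (Matrix.GeneralLinearGroup.det g : ZMod 5) = 0 := by
        rw [Matrix.GeneralLinearGroup.val_det_apply, ← toMat_enc, hg', M2.det_toMat]; decide
      exact (Matrix.GeneralLinearGroup.det g).ne_zero hdet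
    obtain ⟨j, k, hjk⟩ := M2.gen_cert a c hac
    have hg'' : g = tau ^ (j : ℕ) * nu ^ (k : ℕ) := by
      apply enc_injective
      rw [hg', hjk, enc_mul, enc_pow, enc_pow, enc_tau, enc_nu]
    rw [hg'']
    have ht : tau ∈ Subgroup.closure ({tau, nu} : Set (GL (Fin 2) (ZMod 5))) :=
      Subgroup.subset_closure (by simp)
    have hn : nu ∈ Subgroup.closure ({tau, nu} : Set (GL (Fin 2) (ZMod 5))) :=
      Subgroup.subset_closure (by simp)
    exact mul_mem (pow_mem ht _) (pow_mem hn _)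

/-- **The elements of `𝔽₅(τ)^×` of norm `3` are `±τⁱν`** (group-element form of
`exists_eq_tau_pow_mul_of_mem_unitsF5Tau_of_det_eq_three`).
[cite: BCDTJAMS2001, §2.2 (proof of Thm. 2.2.1, p. 860, case 2 and third bullet)] -/
theorem eq_tau_pow_mul_nu_or_of_mem_unitsF5Tau_of_det_eq_three {α : GL (Fin 2) (ZMod 5)}
    (hα : α ∈ unitsF5Tau) (hdet : (Matrix.GeneralLinearGroup.det α : ZMod 5) = 3) :
    ∃ i : ℕ, i < 3 ∧ (α = tau ^ i * nu ∨ α = -(tau ^ i * nu)) := by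
  obtain ⟨i, hi, h⟩ := exists_eq_tau_pow_mul_of_mem_unitsF5Tau_of_det_eq_three hα hdet
  refine ⟨i, hi, ?_⟩
  rw [← val_nu] at h
  rcases h with h | h
  · left
    exact Units.ext (by rw [h, Units.val_mul])
  · right
    exact Units.ext (by rw [h, Units.val_neg, Units.val_mul])

/-- `τⁱ ν τ²ⁱ = ν` (`τ³ = 1`, `τ` and `ν` commute): multiplying `±τⁱν` by the wild-inertia value
`τ²ⁱ` removes the `τⁱ`. [folklore] -/
theorem tau_pow_mul_nu_mul_tau_pow (i : ℕ) : tau ^ i * nu * tau ^ (2 * i) = nu := by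
  have hcomm : nu * tau ^ (2 * i) = tau ^ (2 * i) * nu :=
    (mul_comm_of_mem_unitsF5Tau (pow_mem tau_mem_unitsF5Tau _) nu_mem_unitsF5Tau).symm
  rw [mul_assoc, hcomm, ← mul_assoc, ← pow_add, show i + 2 * i = 3 * i by ring, pow_mul,
    tau_pow_three, one_pow, one_mul]

/-- `-1 ∈ 𝔽₅(τ)^×` (it is central). [folklore] -/
theorem neg_one_mem_unitsF5Tau : (-1 : GL (Fin 2) (ZMod 5)) ∈ unitsF5Tau := by
  rw [mem_unitsF5Tau_iff_mul_eq, neg_one_mul, mul_neg_one]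

/-- `⟨τ, -1⟩ = ⟨τ⟩ ⊔ ⟨-1⟩`. [folklore] -/
theorem closure_tau_neg_one_eq_sup :
    Subgroup.closure ({tau, -1} : Set (GL (Fin 2) (ZMod 5))) =
      Subgroup.zpowers tau ⊔ Subgroup.zpowers (-1) := by
  rw [Set.insert_eq, Subgroup.closure_union, ← Subgroup.zpowers_eq_closure, ← Subgroup.zpowers_eq_closure]

/-- An element `g ∈ N(𝔽₅(τ)^×) ∖ 𝔽₅(τ)^×` of determinant `3` has `g² = 2` and **`g⁴ = -1`** (so
order `8`): the Frobenius in BCDT's case 3. [folklore] -/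
theorem pow_four_eq_neg_one_of_mem_normalizer_of_not_mem {g : GL (Fin 2) (ZMod 5)}
    (hg : g ∈ Subgroup.normalizer (unitsF5Tau : Set (GL (Fin 2) (ZMod 5)))) (hgc : g ∉ unitsF5Tau)
    (hdet : (Matrix.GeneralLinearGroup.det g : ZMod 5) = 3) :
    (((g ^ 2 : GL (Fin 2) (ZMod 5)) : Matrix (Fin 2) (Fin 2) (ZMod 5)) =
        (2 : ZMod 5) • (1 : Matrix (Fin 2) (Fin 2) (ZMod 5))) ∧
      g ^ 4 = -1 := by
  have hsq : (((g ^ 2 : GL (Fin 2) (ZMod 5)) : Matrix (Fin 2) (Fin 2) (ZMod 5)) =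
      (2 : ZMod 5) • (1 : Matrix (Fin 2) (Fin 2) (ZMod 5))) := by
    rw [val_sq_of_mem_normalizer_of_not_mem hg hgc, hdet]
    ext i j; fin_cases i <;> fin_cases j <;> decide
  refine ⟨hsq, Units.ext ?_⟩
  rw [show (4 : ℕ) = 2 + 2 from rfl, pow_add, Units.val_mul, hsq, Units.val_neg, Units.val_one,
    smul_mul_smul, Matrix.one_mul]
  ext i j; fin_cases i <;> fin_cases j <;> decide

end Literature.NumberTheory.GaloisRepresentations.GL2F5OrderThree

namespace Literature.NumberTheory.GaloisRepresentations

open Field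

/-! ## Frobenius elements: multiplication by inertia, and generation of the decomposition group -/

/-- **An arithmetic Frobenius times an element of the inertia group is an arithmetic Frobenius**:
if `φ • x ≡ x^q` and `s • x ≡ x (mod Q)` for all `x`, then `(φ s) • x ≡ x^q (mod Q)` (`φ`
stabilises `Q`).  Ref: Neukirch, *Algebraic Number Theory*, Ch. I §9, (9.4)–(9.5). [folklore] -/
theorem isArithFrobAt_mul_of_mem_inertia {R S G : Type*} [CommRing R] [CommRing S] [Algebra R S]
    [Group G] [MulSemiringAction G S] [SMulCommClass G R S] {Q : Ideal S} [Q.IsPrime] {φ s : G}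
    (hφ : IsArithFrobAt R φ Q) (hs : s ∈ Q.inertia G) : IsArithFrobAt R (φ * s) Q := by
  intro x
  have h1 : s • x - x ∈ Q := hs x
  have h2 : φ • (s • x - x) ∈ Q := by
    have h := Ideal.smul_mem_pointwise_smul φ _ Q h1
    rwa [MulAction.mem_stabilizer_iff.mp hφ.mem_stabilizer] at h
  have h3 : φ • x - x ^ Nat.card (R ⧸ Q.under R) ∈ Q := by
    simpa [MulSemiringAction.toAlgHom_apply] using hφ x
  have e : (φ * s) • x - x ^ Nat.card (R ⧸ Q.under R) =
      φ • (s • x - x) + (φ • x - x ^ Nat.card (R ⧸ Q.under R)) := by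
    rw [mul_smul, smul_sub]; ring
  simpa [MulSemiringAction.toAlgHom_apply, e] using add_mem h2 h3

/-- An element of the inertia group times an arithmetic Frobenius is an arithmetic Frobenius.
Ref: Neukirch, *Algebraic Number Theory*, Ch. I §9, (9.4)–(9.5). [folklore] -/
theorem isArithFrobAt_mul_of_mem_inertia_left {R S G : Type*} [CommRing R] [CommRing S]
    [Algebra R S] [Group G] [MulSemiringAction G S] [SMulCommClass G R S] {Q : Ideal S} {φ s : G}
    (hφ : IsArithFrobAt R φ Q) (hs : s ∈ Q.inertia G) : IsArithFrobAt R (s * φ) Q := by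
  intro x
  have h1 : s • (φ • x) - φ • x ∈ Q := hs (φ • x)
  have h3 : φ • x - x ^ Nat.card (R ⧸ Q.under R) ∈ Q := by
    simpa [MulSemiringAction.toAlgHom_apply] using hφ x
  have e : (s * φ) • x - x ^ Nat.card (R ⧸ Q.under R) =
      (s • (φ • x) - φ • x) + (φ • x - x ^ Nat.card (R ⧸ Q.under R)) := by
    rw [mul_smul]; ring
  simpa [MulSemiringAction.toAlgHom_apply, e] using add_mem h1 h3

variable {K : Type*} [Field K] [NumberField K]

/-- **`f(D_𝔓)` is generated by `f(I_𝔓)` and `f(φ)`.**  Let `K` be a number field, `𝔓 ∣ v` a prime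
of `\bar ℤ_K`, `φ ∈ Γ_K` an arithmetic Frobenius at `𝔓` and `f : Γ_K → H` a homomorphism with open
kernel (e.g. a continuous homomorphism to a discrete group).  Then
`f(D_𝔓) = f(I_𝔓) ⊔ ⟨f φ⟩`: in the finite quotient `Γ_K / ker f` the decomposition group is
generated by inertia and the Frobenius (the tree's
`exists_eq_frobenius_pow_mul_of_mem_decompositionSubgroup`: `d = φⁿ · i · u`, `u ∈ ker f`).
[cite: NeukirchANT1999, Ch. I §9 Prop. (9.4)–(9.5)] -/
theorem map_decompositionSubgroup_eq_map_inertia_sup_zpowers {v : HeightOneSpectrum (𝓞 K)}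
    {𝔓 : Ideal (absIntegers (𝓞 K) K)} (h𝔓 : 𝔓 ∈ v.primesAbove) {H : Type*} [Group H]
    (f : absoluteGaloisGroup K →* H) (hf : IsOpen (f.ker : Set (absoluteGaloisGroup K)))
    {φ : absoluteGaloisGroup K} (hφ : IsArithFrobAt (𝓞 K) φ 𝔓) :
    (𝔓.decompositionSubgroup (absoluteGaloisGroup K)).map f =
      (𝔓.inertia (absoluteGaloisGroup K)).map f ⊔ Subgroup.zpowers (f φ) := by
  haveI : 𝔓.IsPrime := h𝔓.1
  apply le_antisymm
  · rintro _ ⟨d, hd, rfl⟩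
    obtain ⟨n, i, u, hi, hu, rfl⟩ :=
      exists_eq_frobenius_pow_mul_of_mem_decompositionSubgroup h𝔓 hφ hf hd
    rw [map_mul, map_mul, (MonoidHom.mem_ker).mp hu, mul_one, map_pow]
    exact mul_mem (Subgroup.mem_sup_right (Subgroup.npow_mem_zpowers _ _))
      (Subgroup.mem_sup_left ⟨i, hi, rfl⟩)
  · refine sup_le (Subgroup.map_mono (Ideal.inertia_le_decompositionSubgroup _ _)) ?_
    rw [Subgroup.zpowers_le]
    exact ⟨φ, hφ.mem_stabilizer, rfl⟩

end Literature.NumberTheory.GaloisRepresentations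

namespace Literature.NumberTheory.Automorphic.BCDT

open Field GaloisRepresentations GaloisRepresentations.GL2F5OrderThree

/-! ## BCDT §2.2, cases 2–6: auxiliary steps for a fixed conjugate `f = ρ̄ˣ` -/

section Aux

variable {f : absoluteGaloisGroup ℚ →* GL (Fin 2) (ZMod 5)}
  {𝔓 : Ideal (absIntegers (𝓞 ℚ) ℚ)}

/-- The kernel of `σ ↦ x ρ̄(σ) x⁻¹` is open (`ρ̄` is continuous, `GL₂(𝔽₅)` discrete). [folklore] -/
theorem isOpen_ker_conj_comp (ρ : ModPGaloisRep ℚ (ZMod 5) 2) (x : GL (Fin 2) (ZMod 5)) :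
    IsOpen ((((MulAut.conj x).toMonoidHom.comp ρ.toMonoidHom).ker :
      Set (absoluteGaloisGroup ℚ))) := by
  have hset : ((((MulAut.conj x).toMonoidHom.comp ρ.toMonoidHom).ker :
      Set (absoluteGaloisGroup ℚ))) = ρ ⁻¹' {1} := by
    ext σ
    simp only [SetLike.mem_coe, MonoidHom.mem_ker, MonoidHom.coe_comp, Function.comp_apply,
      MulEquiv.coe_toMonoidHom, MulEquiv.map_eq_one_iff, Set.mem_preimage, Set.mem_singleton_iff]
    rfl
  rw [hset]
  exact (isOpen_discrete _).preimage (map_continuous ρ)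

/-- **Index `2`.**  If `f(D_𝔓) ≤ N(𝔽₅(τ)^×)` and some `a ∈ D_𝔓` has `f a ∉ 𝔽₅(τ)^×`, then
`H = f⁻¹(𝔽₅(τ)^×)` meets `D_𝔓` in a subgroup of index `2` (`N(𝔽₅(τ)^×)/𝔽₅(τ)^×` has order `2`:
`mul_mem_unitsF5Tau_of_not_mem_of_not_mem`).  BCDT: the quadratic field `M/ℚ₃` of cases 3–6.
[cite: BCDTJAMS2001, §2.2 (proof of Thm. 2.2.1, p. 860, cases 3–6)] -/
theorem relIndex_comap_unitsF5Tau_eq_two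
    (hN : ∀ σ ∈ 𝔓.decompositionSubgroup (absoluteGaloisGroup ℚ),
      f σ ∈ Subgroup.normalizer (unitsF5Tau : Set (GL (Fin 2) (ZMod 5))))
    {a : absoluteGaloisGroup ℚ} (haD : a ∈ 𝔓.decompositionSubgroup (absoluteGaloisGroup ℚ))
    (haH : f a ∉ unitsF5Tau) :
    (unitsF5Tau.comap f).relIndex (𝔓.decompositionSubgroup (absoluteGaloisGroup ℚ)) = 2 := by
  rw [Subgroup.relIndex_eq_two_iff_exists_notMem_and]
  refine ⟨a, haD, haH, fun b hbD ↦ ?_⟩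
  by_cases hbH : b ∈ unitsF5Tau.comap f
  · exact Or.inr hbH
  · left
    change f (b * a) ∈ unitsF5Tau
    rw [map_mul]
    exact mul_mem_unitsF5Tau_of_not_mem_of_not_mem (hN b hbD) (hN a haD) hbH haH

/-- **Normalising the Frobenius by wild inertia** (cases 2 and 4–6): if `t ∈ I_𝔓` has `f t = τ`
and the arithmetic Frobenius `φ` has `f φ ∈ 𝔽₅(τ)^×` of determinant `3`, i.e. `f φ = ±τⁱν`, then
`φ' = φ t²ⁱ` is an arithmetic Frobenius with `f φ' = ±ν`.
[cite: BCDTJAMS2001, §2.2 (proof of Thm. 2.2.1, p. 860, cases 2 and 4–6)] -/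
theorem exists_isArithFrobAt_apply_eq_nu_or [𝔓.IsPrime] {t : absoluteGaloisGroup ℚ}
    (ht : t ∈ 𝔓.inertia (absoluteGaloisGroup ℚ)) (hft : f t = tau)
    {φ : absoluteGaloisGroup ℚ} (hφ : IsArithFrobAt (𝓞 ℚ) φ 𝔓) (hφC : f φ ∈ unitsF5Tau)
    (hdet : (Matrix.GeneralLinearGroup.det (f φ) : ZMod 5) = 3) :
    ∃ φ' : absoluteGaloisGroup ℚ, IsArithFrobAt (𝓞 ℚ) φ' 𝔓 ∧ (f φ' = nu ∨ f φ' = -nu) := by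
  obtain ⟨i, -, h⟩ := eq_tau_pow_mul_nu_or_of_mem_unitsF5Tau_of_det_eq_three hφC hdet
  refine ⟨φ * t ^ (2 * i), isArithFrobAt_mul_of_mem_inertia hφ (pow_mem ht _), ?_⟩
  rw [map_mul, map_pow, hft]
  rcases h with h | h
  · left
    rw [h, tau_pow_mul_nu_mul_tau_pow]
  · right
    rw [h, neg_mul, tau_pow_mul_nu_mul_tau_pow]

/-- **Normalising the Frobenius by inertia** (cases 4–6): if moreover `s ∈ I_𝔓` has `f s = σ`
(so `f(s²) = -1`), then some arithmetic Frobenius `φ'` has `f φ' = ν` exactly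
("`√±3 ↦ τ - τ⁻¹`").  [cite: BCDTJAMS2001, §2.2 (proof of Thm. 2.2.1, p. 860, cases 4–6)] -/
theorem exists_isArithFrobAt_apply_eq_nu [𝔓.IsPrime] {t : absoluteGaloisGroup ℚ}
    (ht : t ∈ 𝔓.inertia (absoluteGaloisGroup ℚ)) (hft : f t = tau)
    {s : absoluteGaloisGroup ℚ} (hs : s ∈ 𝔓.inertia (absoluteGaloisGroup ℚ)) (hfs : f s = sigma)
    {φ : absoluteGaloisGroup ℚ} (hφ : IsArithFrobAt (𝓞 ℚ) φ 𝔓) (hφC : f φ ∈ unitsF5Tau)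
    (hdet : (Matrix.GeneralLinearGroup.det (f φ) : ZMod 5) = 3) :
    ∃ φ' : absoluteGaloisGroup ℚ, IsArithFrobAt (𝓞 ℚ) φ' 𝔓 ∧ f φ' = nu := by
  obtain ⟨φ₁, hφ₁, h⟩ := exists_isArithFrobAt_apply_eq_nu_or ht hft hφ hφC hdet
  rcases h with h | h
  · exact ⟨φ₁, hφ₁, h⟩
  · refine ⟨φ₁ * s ^ 2, isArithFrobAt_mul_of_mem_inertia hφ₁ (pow_mem hs 2), ?_⟩
    rw [map_mul, map_pow, hfs, sigma_sq, h, neg_mul_neg, mul_one]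

end Aux

/-! ## BCDT §2.2, cases 2–6: the image of `G₃`, case by case -/

/-- **BCDT, proof of Theorem 2.2.1, cases 2–6: the image of the decomposition group at `3` and the
Frobenius, case by case.**  Let `ρ̄ : Γ_ℚ → GL₂(𝔽₅)` be continuous with `det ρ̄ = χ̄₅` and NOT tamely
ramified above `3`.  Then there are a place `v ∣ 3`, a prime `𝔓 ∣ v` of `ℚ̄` and `x ∈ GL₂(𝔽₅)` such
that, with `f = xρ̄x⁻¹`, `D = D_𝔓`, `I = I_𝔓` and `H = f⁻¹(𝔽₅(τ)^×)`:
* `f(D) ≤ N(𝔽₅(τ)^×)`, the wild ramification groups map onto `⟨τ⟩`, arithmetic Frobenius elements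
  at `𝔓` exist, and for every one of them `f(D) = f(I) ⊔ ⟨f φ⟩` (Neukirch I (9.4));
* and exactly one of the following holds:
  - **(case 2)** `D ≤ H`, `f(D) = 𝔽₅(τ)^×` (the non-split Cartan subgroup, cyclic of order `24`:
    "`ρ̄|_{G₃}` is given by a character `ℚ₃^× → 𝔽₅(τ)^×`"), `f(I) = ⟨τ⟩` or `⟨τ, -1⟩`
    ("`4 ↦ τ`, `-1 ↦ ±1`"), every arithmetic Frobenius `φ` has `f φ = ±τⁱν` and some has
    `f φ = ±ν` ("`3 ↦ τⁱ(τ - τ⁻¹)`", up to the quadratic twist);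
  - **(case 3)** `I ≤ H` but `D ≰ H`: `[D : H ∩ D] = 2` (the unramified quadratic `ℚ₃(√-1)`),
    `f(I) = ⟨τ⟩` or `⟨τ, -1⟩`, and every arithmetic Frobenius `φ` has `f φ ∉ 𝔽₅(τ)^×`,
    `(f φ)² = 2`, `(f φ)⁴ = -1` and `f(D) = ⟨τ⟩ ⊔ ⟨f φ⟩` (`= ⟨τ⟩ ⋊ ℤ/8`, `f φ` inverting `τ`);
  - **(cases 4–6)** `I ≰ H`: `[D : H ∩ D] = 2` (a ramified quadratic `ℚ₃(√±3)`), `f(I) = ⟨τ, σ⟩`,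
    `f(I ∩ H) = ⟨τ, -1⟩` ("`-1 ↦ -1`" on the inertia subgroup of the quadratic field), some
    arithmetic Frobenius `φ ∈ H` has `f φ = ν = τ - τ⁻¹` exactly ("`√±3 ↦ τ - τ⁻¹`"), and
    `f(D) = N(𝔽₅(τ)^×)` (order `48`).
[cite: BCDTJAMS2001, §2.2 (proof of Thm. 2.2.1, p. 860, cases 2–6)] -/
theorem exists_conj_cases_of_not_isTamelyRamifiedAbove_three_of_det (ρ : ModPGaloisRep ℚ (ZMod 5) 2)
    (hdet : ∀ σ : absoluteGaloisGroup ℚ,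
      Matrix.GeneralLinearGroup.det (ρ σ) = modPCyclotomicCharacterZMod ℚ 5 σ)
    (hwild : ¬ ρ.IsTamelyRamifiedAbove 3) :
    ∃ v : HeightOneSpectrum (𝓞 ℚ), ((3 : ℕ) : 𝓞 ℚ) ∈ v.asIdeal ∧ ∃ 𝔓 ∈ v.primesAbove,
      ∃ x : GL (Fin 2) (ZMod 5),
        -- common data
        (∀ σ ∈ 𝔓.decompositionSubgroup (absoluteGaloisGroup ℚ),
            x * ρ σ * x⁻¹ ∈ Subgroup.normalizer (unitsF5Tau : Set (GL (Fin 2) (ZMod 5)))) ∧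
        (∃ u : ℝ, 0 < u ∧
          (absUpperRamificationSubgroup (𝓞 ℚ) 𝔓 u).map
              ((MulAut.conj x).toMonoidHom.comp ρ.toMonoidHom) = Subgroup.zpowers tau) ∧
        (∃ φ : absoluteGaloisGroup ℚ, IsArithFrobAt (𝓞 ℚ) φ 𝔓) ∧
        (∀ φ : absoluteGaloisGroup ℚ, IsArithFrobAt (𝓞 ℚ) φ 𝔓 →
          (𝔓.decompositionSubgroup (absoluteGaloisGroup ℚ)).map
              ((MulAut.conj x).toMonoidHom.comp ρ.toMonoidHom) =
            (𝔓.inertia (absoluteGaloisGroup ℚ)).map ((MulAut.conj x).toMonoidHom.comp ρ.toMonoidHom) ⊔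
              Subgroup.zpowers (x * ρ φ * x⁻¹)) ∧
        -- the three cases
        (-- case 2
          (𝔓.decompositionSubgroup (absoluteGaloisGroup ℚ) ≤
              unitsF5Tau.comap ((MulAut.conj x).toMonoidHom.comp ρ.toMonoidHom) ∧
            (𝔓.decompositionSubgroup (absoluteGaloisGroup ℚ)).map
                ((MulAut.conj x).toMonoidHom.comp ρ.toMonoidHom) = unitsF5Tau ∧
            ((𝔓.inertia (absoluteGaloisGroup ℚ)).map ((MulAut.conj x).toMonoidHom.comp ρ.toMonoidHom) =
                  Subgroup.zpowers tau ∨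
              (𝔓.inertia (absoluteGaloisGroup ℚ)).map ((MulAut.conj x).toMonoidHom.comp ρ.toMonoidHom) =
                  Subgroup.closure {tau, -1}) ∧
            (∀ φ : absoluteGaloisGroup ℚ, IsArithFrobAt (𝓞 ℚ) φ 𝔓 →
              ∃ i : ℕ, i < 3 ∧ (x * ρ φ * x⁻¹ = tau ^ i * nu ∨ x * ρ φ * x⁻¹ = -(tau ^ i * nu))) ∧
            (∃ φ : absoluteGaloisGroup ℚ, IsArithFrobAt (𝓞 ℚ) φ 𝔓 ∧
              (x * ρ φ * x⁻¹ = nu ∨ x * ρ φ * x⁻¹ = -nu))) ∨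
          -- case 3
          (𝔓.inertia (absoluteGaloisGroup ℚ) ≤
              unitsF5Tau.comap ((MulAut.conj x).toMonoidHom.comp ρ.toMonoidHom) ∧
            ¬ 𝔓.decompositionSubgroup (absoluteGaloisGroup ℚ) ≤
              unitsF5Tau.comap ((MulAut.conj x).toMonoidHom.comp ρ.toMonoidHom) ∧
            (unitsF5Tau.comap ((MulAut.conj x).toMonoidHom.comp ρ.toMonoidHom)).relIndex
                (𝔓.decompositionSubgroup (absoluteGaloisGroup ℚ)) = 2 ∧
            ((𝔓.inertia (absoluteGaloisGroup ℚ)).map ((MulAut.conj x).toMonoidHom.comp ρ.toMonoidHom) =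
                  Subgroup.zpowers tau ∨
              (𝔓.inertia (absoluteGaloisGroup ℚ)).map ((MulAut.conj x).toMonoidHom.comp ρ.toMonoidHom) =
                  Subgroup.closure {tau, -1}) ∧
            (∀ φ : absoluteGaloisGroup ℚ, IsArithFrobAt (𝓞 ℚ) φ 𝔓 →
              x * ρ φ * x⁻¹ ∉ unitsF5Tau ∧
              (((x * ρ φ * x⁻¹) ^ 2 : GL (Fin 2) (ZMod 5)) : Matrix (Fin 2) (Fin 2) (ZMod 5)) =
                  (2 : ZMod 5) • (1 : Matrix (Fin 2) (Fin 2) (ZMod 5)) ∧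
              (x * ρ φ * x⁻¹) ^ 4 = -1 ∧
              (𝔓.decompositionSubgroup (absoluteGaloisGroup ℚ)).map
                  ((MulAut.conj x).toMonoidHom.comp ρ.toMonoidHom) =
                Subgroup.zpowers tau ⊔ Subgroup.zpowers (x * ρ φ * x⁻¹))) ∨
          -- cases 4–6
          (¬ 𝔓.inertia (absoluteGaloisGroup ℚ) ≤
              unitsF5Tau.comap ((MulAut.conj x).toMonoidHom.comp ρ.toMonoidHom) ∧
            (unitsF5Tau.comap ((MulAut.conj x).toMonoidHom.comp ρ.toMonoidHom)).relIndex
                (𝔓.decompositionSubgroup (absoluteGaloisGroup ℚ)) = 2 ∧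
            (𝔓.inertia (absoluteGaloisGroup ℚ)).map ((MulAut.conj x).toMonoidHom.comp ρ.toMonoidHom) =
                Subgroup.closure {tau, sigma} ∧
            (𝔓.inertia (absoluteGaloisGroup ℚ) ⊓
                  unitsF5Tau.comap ((MulAut.conj x).toMonoidHom.comp ρ.toMonoidHom)).map
                ((MulAut.conj x).toMonoidHom.comp ρ.toMonoidHom) = Subgroup.closure {tau, -1} ∧
            (∃ φ : absoluteGaloisGroup ℚ, IsArithFrobAt (𝓞 ℚ) φ 𝔓 ∧
              φ ∈ unitsF5Tau.comap ((MulAut.conj x).toMonoidHom.comp ρ.toMonoidHom) ∧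
              x * ρ φ * x⁻¹ = nu) ∧
            (𝔓.decompositionSubgroup (absoluteGaloisGroup ℚ)).map
                ((MulAut.conj x).toMonoidHom.comp ρ.toMonoidHom) =
              Subgroup.normalizer (unitsF5Tau : Set (GL (Fin 2) (ZMod 5))))) := by
  obtain ⟨v, hv, 𝔓, h𝔓, x, hN, hI, hF, -, hwild', hS₁, hS₂, htri⟩ :=
    exists_conj_of_not_isTamelyRamifiedAbove_three_of_det ρ hdet hwild
  haveI : 𝔓.IsPrime := h𝔓.1
  set f := (MulAut.conj x).toMonoidHom.comp ρ.toMonoidHom with hf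
  have hfapply : ∀ σ, f σ = x * ρ σ * x⁻¹ := fun σ ↦ rfl
  set D := 𝔓.decompositionSubgroup (absoluteGaloisGroup ℚ) with hD
  set I := 𝔓.inertia (absoluteGaloisGroup ℚ) with hIdef
  set H := unitsF5Tau.comap f with hH
  have hID : I ≤ D := Ideal.inertia_le_decompositionSubgroup _ _
  -- Frobenius elements exist, lie in `D`, and generate `f(D)` together with `f(I)`
  have hexφ : ∃ φ : absoluteGaloisGroup ℚ, IsArithFrobAt (𝓞 ℚ) φ 𝔓 :=
    IsDedekindDomain.HeightOneSpectrum.exists_isArithFrobAt_of_mem_primesAbove_holds h𝔓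
  have hker : IsOpen ((f.ker : Set (absoluteGaloisGroup ℚ))) := isOpen_ker_conj_comp ρ x
  have hgen : ∀ φ : absoluteGaloisGroup ℚ, IsArithFrobAt (𝓞 ℚ) φ 𝔓 →
      D.map f = I.map f ⊔ Subgroup.zpowers (f φ) := fun φ hφ ↦
    map_decompositionSubgroup_eq_map_inertia_sup_zpowers h𝔓 f hker hφ
  -- an inertia element `t` with `f t = τ`
  obtain ⟨t, htI, hft⟩ : ∃ t ∈ I, f t = tau := hS₁ (Subgroup.mem_zpowers tau)
  have htH : t ∈ H := by
    change f t ∈ unitsF5Tau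
    rw [hft]; exact tau_mem_unitsF5Tau
  -- `f(D) ≤ N(C)` as subgroups
  have hDN : D.map f ≤ Subgroup.normalizer (unitsF5Tau : Set (GL (Fin 2) (ZMod 5))) := by
    rintro _ ⟨d, hd, rfl⟩; exact hN d hd
  -- if `I ≤ H` and some Frobenius lies in `H` then `D ≤ H` (case 2 versus case 3)
  have hcase2 : I ≤ H → ∀ φ : absoluteGaloisGroup ℚ, IsArithFrobAt (𝓞 ℚ) φ 𝔓 → φ ∈ H → D ≤ H := by
    intro hIH φ hφ hφH
    rw [hH, ← Subgroup.map_le_iff_le_comap, hgen φ hφ]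
    exact sup_le (Subgroup.map_le_iff_le_comap.mpr hIH) (Subgroup.zpowers_le.mpr hφH)
  refine ⟨v, hv, 𝔓, h𝔓, x, hN, hwild', hexφ, hgen, ?_⟩
  obtain ⟨φ₀, hφ₀⟩ := hexφ
  have hφ₀D : φ₀ ∈ D := (hF φ₀ hφ₀).1
  by_cases hIH : I ≤ H
  · -- inertia maps into the Cartan subgroup: cases 2 and 3
    have hIimg : I.map f = Subgroup.zpowers tau ∨ I.map f = Subgroup.closure {tau, -1} := by
      rcases htri with h | h | h
      · exact Or.inl h
      · exact Or.inr h
      · exfalso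
        refine closure_tau_neg_one_le_unitsF5Tau.2 ?_
        rw [← h]
        exact Subgroup.map_le_iff_le_comap.mpr hIH
    by_cases hφ₀H : φ₀ ∈ H
    · -- **case 2**: `D ≤ H`
      left
      have hDH : D ≤ H := hcase2 hIH φ₀ hφ₀ hφ₀H
      have hfrob : ∀ φ : absoluteGaloisGroup ℚ, IsArithFrobAt (𝓞 ℚ) φ 𝔓 →
          ∃ i : ℕ, i < 3 ∧ (f φ = tau ^ i * nu ∨ f φ = -(tau ^ i * nu)) := fun φ hφ ↦
        eq_tau_pow_mul_nu_or_of_mem_unitsF5Tau_of_det_eq_three (hDH (hF φ hφ).1) (hF φ hφ).2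
      have hfrob' : ∃ φ : absoluteGaloisGroup ℚ, IsArithFrobAt (𝓞 ℚ) φ 𝔓 ∧ (f φ = nu ∨ f φ = -nu) :=
        exists_isArithFrobAt_apply_eq_nu_or htI hft hφ₀ (hDH hφ₀D) (hF φ₀ hφ₀).2
      refine ⟨hDH, le_antisymm (Subgroup.map_le_iff_le_comap.mpr hDH) ?_, hIimg, hfrob, hfrob'⟩
      -- `C = ⟨τ, ν⟩ ≤ f(D)`
      rw [← closure_tau_nu_eq_unitsF5Tau, Subgroup.closure_le]
      have hτ : tau ∈ D.map f := ⟨t, hID htI, hft⟩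
      have hν : nu ∈ D.map f := by
        obtain ⟨φ, hφ, h | h⟩ := hfrob'
        · exact ⟨φ, (hF φ hφ).1, h⟩
        · have hνm : -nu ∈ D.map f := ⟨φ, (hF φ hφ).1, h⟩
          have hm1 : (-1 : GL (Fin 2) (ZMod 5)) ∈ D.map f := by
            have h4 := pow_mem hνm 4
            rwa [neg_pow, nu_pow_four, Even.neg_one_pow (by decide), one_mul] at h4
          have e : nu = (-1) * (-nu) := by rw [neg_one_mul, neg_neg]
          rw [e]
          exact mul_mem hm1 hνm
      intro u hu
      simp only [Set.mem_insert_iff, Set.mem_singleton_iff] at hu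
      rcases hu with rfl | rfl
      · exact hτ
      · exact hν
    · -- **case 3**: `I ≤ H`, `D ≰ H`
      right; left
      have hφ₀C : f φ₀ ∉ unitsF5Tau := hφ₀H
      refine ⟨hIH, fun h ↦ hφ₀H (h hφ₀D), relIndex_comap_unitsF5Tau_eq_two hN hφ₀D hφ₀C, hIimg,
        fun φ hφ ↦ ?_⟩
      have hφD : φ ∈ D := (hF φ hφ).1
      have hφC : f φ ∉ unitsF5Tau := fun h ↦ hφ₀H (hcase2 hIH φ hφ h hφ₀D)
      obtain ⟨hsq, h4⟩ := pow_four_eq_neg_one_of_mem_normalizer_of_not_mem (hN φ hφD) hφC (hF φ hφ).2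
      refine ⟨hφC, hsq, h4, ?_⟩
      rw [hgen φ hφ]
      rcases hIimg with h | h
      · rw [h]; rfl
      · rw [h, closure_tau_neg_one_eq_sup, sup_assoc]
        congr 1
        refine sup_eq_right.mpr (Subgroup.zpowers_le.mpr ?_)
        rw [← h4]
        exact Subgroup.npow_mem_zpowers _ 4
  · -- inertia does not map into the Cartan subgroup: **cases 4–6**
    right; right
    have hIS : I.map f = Subgroup.closure {tau, sigma} := by
      rcases htri with h | h | h
      · exact absurd (Subgroup.map_le_iff_le_comap.mp (h.le.trans zpowers_tau_le_unitsF5Tau)) hIH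
      · exact absurd (Subgroup.map_le_iff_le_comap.mp (h.le.trans closure_tau_neg_one_le_unitsF5Tau.1)) hIH
      · exact h
    -- an inertia element `s` with `f s = σ`
    obtain ⟨s, hsI, hfs⟩ : ∃ s ∈ I, f s = sigma := by
      have h : sigma ∈ I.map f := by
        rw [hIS]; exact Subgroup.subset_closure (by simp)
      exact h
    have hsC : f s ∉ unitsF5Tau := by rw [hfs]; exact sigma_not_mem_unitsF5Tau
    have hs2H : s ^ 2 ∈ H := by
      change f (s ^ 2) ∈ unitsF5Tau
      rw [map_pow, hfs, sigma_sq]; exact neg_one_mem_unitsF5Tau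
    -- `f(I ∩ H) = ⟨τ, -1⟩`
    have hIHimg : (I ⊓ H).map f = Subgroup.closure {tau, -1} := by
      apply le_antisymm
      · rintro _ ⟨σ', ⟨hσI, hσH⟩, rfl⟩
        exact mem_closure_tau_neg_one_of_mem_six (mem_six_of_mem_closure_of_mem_unitsF5Tau (hI σ' hσI).2 hσH)
      · rw [Subgroup.closure_le]
        intro u hu
        simp only [Set.mem_insert_iff, Set.mem_singleton_iff] at hu
        rcases hu with rfl | rfl
        · exact ⟨t, ⟨htI, htH⟩, hft⟩
        · exact ⟨s ^ 2, ⟨pow_mem hsI 2, hs2H⟩, by rw [map_pow, hfs, sigma_sq]⟩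
    -- a Frobenius in `H`, normalised to `ν`
    obtain ⟨φ₁, hφ₁, hφ₁C⟩ : ∃ φ₁ : absoluteGaloisGroup ℚ, IsArithFrobAt (𝓞 ℚ) φ₁ 𝔓 ∧ f φ₁ ∈ unitsF5Tau := by
      by_cases h : f φ₀ ∈ unitsF5Tau
      · exact ⟨φ₀, hφ₀, h⟩
      · refine ⟨φ₀ * s, isArithFrobAt_mul_of_mem_inertia hφ₀ hsI, ?_⟩
        rw [map_mul]
        exact mul_mem_unitsF5Tau_of_not_mem_of_not_mem (hN φ₀ hφ₀D) (hN s (hID hsI)) h hsC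
    obtain ⟨φ, hφ, hfφ⟩ := exists_isArithFrobAt_apply_eq_nu htI hft hsI hfs hφ₁ hφ₁C (hF φ₁ hφ₁).2
    have hφD : φ ∈ D := (hF φ hφ).1
    have hφH : φ ∈ H := by
      change f φ ∈ unitsF5Tau
      rw [hfφ]; exact nu_mem_unitsF5Tau
    -- `f(D) = N(C)`
    have hCD : unitsF5Tau ≤ D.map f := by
      rw [← closure_tau_nu_eq_unitsF5Tau, Subgroup.closure_le]
      intro u hu
      simp only [Set.mem_insert_iff, Set.mem_singleton_iff] at hu
      rcases hu with rfl | rfl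
      · exact ⟨t, hID htI, hft⟩
      · exact ⟨φ, hφD, hfφ⟩
    have hDimg : D.map f = Subgroup.normalizer (unitsF5Tau : Set (GL (Fin 2) (ZMod 5))) := by
      refine le_antisymm hDN fun g hg ↦ ?_
      rcases mem_or_sigma_inv_mul_mem_of_mem_normalizer_unitsF5Tau hg with h | h
      · exact hCD h
      · have e : g = sigma * (sigma⁻¹ * g) := by group
        rw [e]
        exact mul_mem ⟨s, hID hsI, hfs⟩ (hCD h)
    exact ⟨hIH, relIndex_comap_unitsF5Tau_eq_two hN (hID hsI) hsC, hIS, hIHimg, ⟨φ, hφ, hφH, hfφ⟩,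
      hDimg⟩

end Literature.NumberTheory.Automorphic.BCDT

end
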